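import Summits.PneNP.PneNP.Theorems.SoloInformedStreamingFloor
import HarnessLib

/-! # SoloInformedStreamingSquare — the state-counting window of the MMW19 door closes at `c = 2` for long inputs

Solo informed, generation 6.  `SoloInformedStreamingFloor` / `SoloInformedStreamingCeiling` give the
time-free window of the McKay–Murray–Williams door `StreamingLowerBound (fun n => n)`: no one-pass
streaming algorithm with `(log₂ N)^c + c` bits of state, `c ≤ 1`, decides `MCSP[n]` (whatever its
update time), while some one-pass algorithm with `(log₂ N)^3 + 3` bits does (update map arbitrary).
Here the ceiling is lowered to the budget of the conjunct `c = 2` at every input length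
`N ≥ 2¹³`, using the SHARP circuit count of `CircuitCountingSharp`
(`#{g : C_{B₂}(g) ≤ n} · n! ≤ 2n · (16(2n+1)²)ⁿ`): the compressed exhaustive-search state of
`Ceil.alg id` has at most `(log₂ N)^2 + 2` bits once `n = log₂ N ≥ 13`.  (For `5 ≤ n ≤ 12` that
algorithm stores the input verbatim, `2ⁿ > n² + 2` bits; whether SOME one-pass algorithm meets
`n² + 2` bits at those finitely many lengths is a finite Myhill–Nerode question left open here.)

Consequence for the door: the conjunct `c = 2` of `StreamingLowerBound (fun n => n)` — and a
fortiori every conjunct `c ≥ 2` — is invisible to state counting at all lengths `N ≥ 2¹³`; its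
content, if any, is uniform update/report TIME (plus a finite check below `2¹³`).

Landed as new mathematics under the host summit per the tree convention; no Literature fact is
introduced. -/

namespace Summit.PneNP.PneNP.Theorems
open Finset Literature.Computability.Complexity Literature.Computability.MetaComplexity
open Literature.Computability.MetaComplexity.McKayMurrayWilliams2019

namespace CeilSq

/-- The sharp count, with the factorial kept: `#easy(n,n) · n! ≤ 2n · (16(2n+1)²)ⁿ` at `n = ⌊log₂ N⌋`. -/
theorem ecard_id_mul_factorial_le (N : ℕ) :
    Ceil.ecard (fun n => n) N * (Ceil.lg N).factorial ≤
      (Ceil.lg N + Ceil.lg N) * (16 * (Ceil.lg N + Ceil.lg N + 1) ^ 2) ^ Ceil.lg N := by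
  simpa [Ceil.ecard, Ceil.easySet] using
    CircuitCount.card_circuitSizeOver_le_mul_factorial_le (Ceil.lg N) (Ceil.lg N)

/-- `(2n+1)² ≤ 2^(n-7)` for `n ≥ 18`. -/
theorem sq_le_two_pow {n : ℕ} (hn : 18 ≤ n) : (n + n + 1) ^ 2 ≤ 2 ^ (n - 7) := by
  induction n, hn using Nat.le_induction with
  | base => norm_num
  | succ k hk ih =>
    have h1 : (k + 1 + (k + 1) + 1) ^ 2 = (k + k + 1) ^ 2 + (8 * k + 8) := by ring
    have h2 : 8 * k + 8 ≤ (k + k + 1) ^ 2 := by nlinarith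
    have h3 : 2 ^ (k + 1 - 7) = 2 * 2 ^ (k - 7) := by
      rw [show k + 1 - 7 = (k - 7) + 1 by omega, pow_succ]; ring
    rw [h1, h3]; omega

/-- `2n + 1 ≤ 2ⁿ` for `n ≥ 3`. -/
theorem two_mul_succ_le_two_pow {n : ℕ} (hn : 3 ≤ n) : n + n + 1 ≤ 2 ^ n := by
  induction n, hn using Nat.le_induction with
  | base => norm_num
  | succ k hk ih => rw [pow_succ]; omega

/-- The numeric heart, large arities: for `n ≥ 18` the crude count (factorial discarded) already
fits `(2ⁿ+1)(E+1) < 2^(n²+1)`. -/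
theorem key_large {n E : ℕ} (hn : 18 ≤ n)
    (hE : E * n.factorial ≤ (n + n) * (16 * (n + n + 1) ^ 2) ^ n) :
    (2 ^ n + 1) * (E + 1) < 2 ^ (n ^ 2 + 1) := by
  set X := 16 * (n + n + 1) ^ 2 with hX
  have hE1 : E ≤ (n + n) * X ^ n :=
    (Nat.le_mul_of_pos_right E (Nat.factorial_pos n)).trans hE
  have hX0 : 0 < X := by positivity
  have hX1 : 1 ≤ X ^ n := Nat.one_le_pow _ _ hX0
  have h2n : n + n + 1 ≤ 2 ^ n := two_mul_succ_le_two_pow (by omega)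
  have hE2 : E + 1 ≤ 2 ^ n * X ^ n :=
    calc E + 1 ≤ (n + n) * X ^ n + X ^ n := by omega
      _ = (n + n + 1) * X ^ n := by ring
      _ ≤ 2 ^ n * X ^ n := Nat.mul_le_mul_right _ h2n
  have hXle : X ≤ 2 ^ (n - 3) :=
    calc X = 16 * (n + n + 1) ^ 2 := rfl
      _ ≤ 2 ^ 4 * 2 ^ (n - 7) := Nat.mul_le_mul (by norm_num) (sq_le_two_pow hn)
      _ = 2 ^ (n - 3) := by rw [← pow_add]; congr 1; omega
  have hN1 : 2 ^ n + 1 ≤ 2 ^ (n + 1) := by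
    have := Nat.one_le_two_pow (n := n); rw [pow_succ]; omega
  obtain ⟨m, hm⟩ : ∃ m, m = n * n := ⟨_, rfl⟩
  have h3 : 3 * n ≤ m := hm ▸ Nat.mul_le_mul_right n (by omega)
  have hexp : n + 1 + (n + (n - 3) * n) < n ^ 2 + 1 := by
    rw [Nat.sub_mul, sq, ← hm]; omega
  calc (2 ^ n + 1) * (E + 1) ≤ 2 ^ (n + 1) * (2 ^ n * X ^ n) := Nat.mul_le_mul hN1 hE2
    _ ≤ 2 ^ (n + 1) * (2 ^ n * (2 ^ (n - 3)) ^ n) := by gcongr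
    _ = 2 ^ (n + 1 + (n + (n - 3) * n)) := by rw [← pow_mul, ← pow_add, ← pow_add]
    _ < 2 ^ (n ^ 2 + 1) := Nat.pow_lt_pow_right (by norm_num) hexp

set_option exponentiation.threshold 400 in
/-- The numeric heart, `13 ≤ n ≤ 17`: here the factor `n!` of the sharp count is needed, and the
five instances are checked by evaluation. -/
theorem key_small {n E : ℕ} (h13 : 13 ≤ n) (h17 : n ≤ 17)
    (hE : E * n.factorial ≤ (n + n) * (16 * (n + n + 1) ^ 2) ^ n) :
    (2 ^ n + 1) * (E + 1) < 2 ^ (n ^ 2 + 1) := by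
  refine Nat.lt_of_mul_lt_mul_right (a := n.factorial) ?_
  calc (2 ^ n + 1) * (E + 1) * n.factorial
      = (2 ^ n + 1) * (E * n.factorial + n.factorial) := by ring
    _ ≤ (2 ^ n + 1) * ((n + n) * (16 * (n + n + 1) ^ 2) ^ n + n.factorial) := by gcongr
    _ < 2 ^ (n ^ 2 + 1) * n.factorial := by
      interval_cases n <;> decide

/-- The numeric heart for all `n ≥ 13`. -/
theorem key {n E : ℕ} (hn : 13 ≤ n)
    (hE : E * n.factorial ≤ (n + n) * (16 * (n + n + 1) ^ 2) ^ n) :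
    (2 ^ n + 1) * (E + 1) < 2 ^ (n ^ 2 + 1) := by
  by_cases h : n ≤ 17
  · exact key_small hn h hE
  · exact key_large (by omega) hE

/-- **The space of `Ceil.alg id` is at most `(log₂ N)² + 2` at every length `N ≥ 2¹³`.** -/
theorem space_id_le_sq {N : ℕ} (hN : 2 ^ 13 ≤ N) :
    Ceil.space (fun n => n) N ≤ Nat.log 2 N ^ 2 + 2 := by
  unfold Ceil.space
  split_ifs with hP
  · obtain ⟨n, hn⟩ : ∃ n, Ceil.lg N = n := ⟨_, rfl⟩
    have hNn : N = 2 ^ n := by rw [← hn]; exact hP.symm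
    have h13 : 13 ≤ n := by
      by_contra h
      have : 2 ^ n < 2 ^ 13 := Nat.pow_lt_pow_right (by norm_num) (by omega)
      omega
    show min N (Ceil.width (fun n => n) N + 1) ≤ Ceil.lg N ^ 2 + 2
    rw [hn]
    refine (min_le_right _ _).trans ?_
    have hE := ecard_id_mul_factorial_le N
    rw [hn] at hE
    have hM : (N + 1) * (Ceil.ecard (fun n => n) N + 1) < 2 ^ (n ^ 2 + 1) := by
      have h := key h13 hE
      rwa [← hNn] at h
    have hM0 : (N + 1) * (Ceil.ecard (fun n => n) N + 1) ≠ 0 :=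
      Nat.mul_ne_zero (Nat.succ_ne_zero _) (Nat.succ_ne_zero _)
    have hlog := (Nat.log_lt_iff_lt_pow one_lt_two hM0).2 hM
    unfold Ceil.width
    omega
  · simp

end CeilSq

/-- **State counting reaches the budget of conjunct `c = 2` on all long inputs.**  `MCSP[n]`
(`MCSPSize id`) is decided by a one-pass streaming algorithm with empty initial state whose state
has at most `(log₂ N)² + 2` bits at every input length `N ≥ 2¹³` (and at most `N` bits below).
No update-time claim is made. -/
theorem soloInformed_mcspSize_id_decides_in_space_sq_eventually :
    ∃ A : StreamingAlgorithm, (∀ N, A.init N = []) ∧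
      RunsInSpace A (fun N => if N < 2 ^ 13 then N else Nat.log 2 N ^ 2 + 2) ∧
      A.Decides (MCSPSize fun n => n) := by
  refine ⟨Ceil.alg (fun n => n), fun _ => rfl,
    fun N x hx => (Ceil.alg_runsInSpace (fun n => n) N x hx).trans ?_, Ceil.alg_decides _⟩
  show Ceil.space (fun n => n) N ≤ if N < 2 ^ 13 then N else Nat.log 2 N ^ 2 + 2
  split_ifs with h
  · unfold Ceil.space
    split_ifs
    · exact min_le_left _ _
    · exact Nat.zero_le _
  · exact CeilSq.space_id_le_sq (not_lt.1 h)

/-- **The time-free window of the `s = id` door, sharpened.**  State counting refutes the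
conjuncts `c ≤ 1` of `StreamingLowerBound (fun n => n)` for EVERY one-pass algorithm, and meets
the space budget of the conjunct `c = 2` at every length `N ≥ 2¹³` for SOME one-pass algorithm
(arbitrary update map).  Hence every conjunct `c ≥ 2` of the door, if true, is true for reasons
of uniform update/report time (or of the finitely many lengths `N < 2¹³`) — not of state. -/
theorem soloInformed_stateCounting_window_sq :
    (∀ c ≤ 1, ¬ ∃ A : StreamingAlgorithm,
        RunsInSpace A (fun N => Nat.log 2 N ^ c + c) ∧ A.Decides (MCSPSize fun n => n)) ∧
    (∃ A : StreamingAlgorithm, (∀ N, A.init N = []) ∧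
        RunsInSpace A (fun N => if N < 2 ^ 13 then N else Nat.log 2 N ^ 2 + 2) ∧
        A.Decides (MCSPSize fun n => n)) :=
  ⟨soloInformed_stateCounting_window.1, soloInformed_mcspSize_id_decides_in_space_sq_eventually⟩

end Summit.PneNP.PneNP.Theorems
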